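import Summits.MatrixMultiplication.OmegaCensus.STPPRankMonotone
import Literature.Computability.AlgebraicComplexity.MatMulM22RankLowerBoundProofs
import Literature.Computability.AlgebraicComplexity.SmallFormatRankProofs
import Literature.Computability.AlgebraicComplexity.LafonWinogradRankBound

/-!
# ω-census (abelian STPP census, seat stpp-2), filter N7 part 5: exact single-block ranks from the tree

HONEST FRAMING (pub-omega census; verbatim): lottery ticket; floor = certified bounds/negative ranges.
Census BOOKKEEPING (pub-omega stpp-2 gen 20, 2026-08-27).  Nothing here is progress on `ω`.

Parts 2–4 (`STPPThinFamilies.lean`, `STPPRankMonotone.lean`) put the census filter N7 in the kernel with the single-block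
lower bounds `R(⟨2,2,2⟩) ≥ 7`, `R(⟨2,2,3⟩) ≥ 10`, `R(⟨2,3,3⟩) ≥ 14` (border ranks).  The census engine's second table
(`JOB_N7=paper`: `223 ↦ 11`, `224 ↦ 14`, `333 ↦ 19`) was booked as resting on print facts ×1.  Those print facts are
THEOREMS OF THE TREE over every field — `alekseyev1985_tensorRank_matMulTensor_322_232_223'` (`R(⟨2,2,3⟩) = 11`) and
`alekseevSmirnov2013_tensorRank_matMulTensor_224'` (`R(⟨2,2,4⟩) = 14`), both in `MatMulM22RankLowerBoundProofs.lean`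
(discharge of Alekseev 2015 Thm 1, `3m+2 ≤ R(⟨m,2,2⟩)` for all `m ≥ 3`), and `blaser2003_cor9_holds` (`19 ≤ R(⟨3,3,3⟩)`,
`SmallFormatRankProofs.lean`).  This file turns them into census-shaped kernel statements:

* all orientations over `ℂ` (Bläser 2013 Lemma 5.5): `eleven_le_tensorRank_matMulTensor_223_perm`,
  `fourteen_le_tensorRank_matMulTensor_224_perm`, `three_mul_add_two_le_tensorRank_matMulTensor_22m_perm` (`m ≥ 3`),
  `nineteen_le_tensorRank_matMulTensor_333`, `eighteen_le_tensorRank_matMulTensor_234_perm` (Lafon–Winograd);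
* monotone forms for a block of ANY format dominating them (`tensorRank_matMulTensor_mono`, part 4):
  `three_mul_add_two_le_tensorRank_matMulTensor_of_le` (`3m+2 ≤ R(⟨a,b,c⟩)` if `a,b,c ≥ 2` and one is `≥ m`),
  `eleven_le_tensorRank_matMulTensor_of_le`, `fourteen_le_tensorRank_matMulTensor_of_le_four`,
  `nineteen_le_tensorRank_matMulTensor_of_three_le`;
* filter N7 with these blocks: `three_mul_add_two_add_sum_gain_le_card_of_isSTPP` (one block dominating an orientation of
  `⟨2,2,m⟩`, `m ≥ 3`), `nineteen_add_sum_gain_le_card_of_isSTPP`; and the one-fat-block frontier form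
  `tensorRank_add_sum_card_mul_le_of_isSTPP_of_thin` / `three_mul_add_two_add_sum_card_mul_le_of_isSTPP_of_thin`
  (all other blocks thin, peeled at full volume; stated additively, no truncated subtraction);
* the six minimal undecided beating leaves of the cell's ℤ₅₆ frontier (kit j267433, census.py record `002addb58b8ac4c4`:
  149 leaves under `JOB_N7=kernel`, 143 under `paper`) that differ between the two engine grades — one `⟨2,2,3⟩`-type
  block plus three thin blocks of total volume `46`, `∑ abc = 58` — decided by theorem: no STPP family with these cards
  exists in ANY abelian group of order `≤ 56` (`11 + 46 = 57`): `no_isSTPP_134_223_316_441`, `…_134_232_361_414`,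
  `…_135_223_315_441`, `…_135_223_441_513`, `…_135_232_414_531`, `…_135_232_441_513`.

The engine's `paper` TABLE as a function of the format (`rlbPaper`, the analogue of part 4's `rlbKernel`) is the sibling
file `STPPRankPaperTable.lean`.
-/

noncomputable section

open scoped BigOperators

namespace Summit.MatrixMultiplication.OmegaCensus.STPPRank

open Literature.Computability.AlgebraicComplexity Module Finset

/-! ## The exact small ranks of the tree, over `ℂ`, in all orientations -/

section Ranks

/-- `R(⟨2,2,3⟩), R(⟨2,3,2⟩), R(⟨3,2,2⟩) ≥ 11` over `ℂ` (Alekseyev 1985; in the tree for every field as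
`alekseyev1985_tensorRank_matMulTensor_322_232_223'`). [cite: Alekseyev1985, main theorem (zbMATH 0577.68059)] -/
theorem eleven_le_tensorRank_matMulTensor_223_perm :
    11 ≤ tensorRank (matMulTensor ℂ 2 2 3) ∧ 11 ≤ tensorRank (matMulTensor ℂ 2 3 2) ∧
      11 ≤ tensorRank (matMulTensor ℂ 3 2 2) := by
  obtain ⟨h322, h232, h223⟩ := alekseyev1985_tensorRank_matMulTensor_322_232_223' ℂ
  exact ⟨h223.symm.le, h232.symm.le, h322.symm.le⟩

/-- `R(⟨2,2,4⟩), R(⟨2,4,2⟩), R(⟨4,2,2⟩) ≥ 14` over `ℂ` (Alekseev–Smirnov 2013; in the tree for every field as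
`alekseevSmirnov2013_tensorRank_matMulTensor_224'`; orientations by Bläser 2013 Lemma 5.5).
[cite: AlekseevSmirnov2013, Thm 1 (zbMATH 1317.68061)] -/
theorem fourteen_le_tensorRank_matMulTensor_224_perm :
    14 ≤ tensorRank (matMulTensor ℂ 2 2 4) ∧ 14 ≤ tensorRank (matMulTensor ℂ 2 4 2) ∧
      14 ≤ tensorRank (matMulTensor ℂ 4 2 2) := by
  have h224 : 14 ≤ tensorRank (matMulTensor ℂ 2 2 4) := (alekseevSmirnov2013_tensorRank_matMulTensor_224' ℂ).symm.le
  obtain ⟨h1, -, -, -, h5⟩ := Blaser2013_lemma55 (K := ℂ) 2 2 4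
  exact ⟨h224, h5 ▸ h224, h1 ▸ h224⟩

/-- `3m + 2 ≤ R(⟨2,2,m⟩), R(⟨2,m,2⟩), R(⟨m,2,2⟩)` over `ℂ` for every `m ≥ 3` (Alekseev 2015 Thm 1, in the tree for every
field as `three_mul_add_two_le_tensorRank_matMulTensor_m22`; orientations by Bläser 2013 Lemma 5.5); e.g.
`17 ≤ R(⟨2,2,5⟩)`, `23 ≤ R(⟨2,2,7⟩)` (beyond engine v0.10's tables, which stop at `⟨2,2,4⟩`).
[cite: Alekseev2015ChebyshevM22, Thm 1] -/
theorem three_mul_add_two_le_tensorRank_matMulTensor_22m_perm {m : ℕ} (hm : 3 ≤ m) :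
    3 * m + 2 ≤ tensorRank (matMulTensor ℂ 2 2 m) ∧ 3 * m + 2 ≤ tensorRank (matMulTensor ℂ 2 m 2) ∧
      3 * m + 2 ≤ tensorRank (matMulTensor ℂ m 2 2) := by
  have hm22 : 3 * m + 2 ≤ tensorRank (matMulTensor ℂ m 2 2) := three_mul_add_two_le_tensorRank_matMulTensor_m22 ℂ hm
  obtain ⟨h1, h2, -, -, -⟩ := Blaser2013_lemma55 (K := ℂ) m 2 2
  exact ⟨h2 ▸ hm22, h1 ▸ hm22, hm22⟩

/-- `R(⟨3,3,3⟩) ≥ 19` over `ℂ` (Bläser 2003, Cor. 9; in the tree for every field as `blaser2003_cor9_holds`).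
[cite: Blaser2003, Corollary 9] -/
theorem nineteen_le_tensorRank_matMulTensor_333 : 19 ≤ tensorRank (matMulTensor ℂ 3 3 3) :=
  blaser2003_cor9_holds ℂ

/-- `18 ≤ R(⟨2,3,4⟩)` over `ℂ` in all six orientations (Lafon–Winograd / BCS 1997 Thm (17.12), in the tree for every
field as `eighteen_le_tensorRank_matMulTensor_234`; orientations by Bläser 2013 Lemma 5.5); not used by engine v0.10
(which bounds `⟨2,3,4⟩` through its sub-format `⟨2,3,3⟩`, `14`). [cite: BurgisserClausenShokrollahi1997, Thm (17.12)] -/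
theorem eighteen_le_tensorRank_matMulTensor_234_perm :
    18 ≤ tensorRank (matMulTensor ℂ 2 3 4) ∧ 18 ≤ tensorRank (matMulTensor ℂ 4 2 3) ∧
      18 ≤ tensorRank (matMulTensor ℂ 3 4 2) ∧ 18 ≤ tensorRank (matMulTensor ℂ 3 2 4) ∧
      18 ≤ tensorRank (matMulTensor ℂ 4 3 2) ∧ 18 ≤ tensorRank (matMulTensor ℂ 2 4 3) := by
  have h : 18 ≤ tensorRank (matMulTensor ℂ 2 3 4) := eighteen_le_tensorRank_matMulTensor_234 ℂ
  obtain ⟨h1, h2, h3, h4, h5⟩ := Blaser2013_lemma55 (K := ℂ) 2 3 4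
  exact ⟨h, h1 ▸ h, h2 ▸ h, h3 ▸ h, h4 ▸ h, h5 ▸ h⟩

/-- `3m + 2 ≤ R(⟨a,b,c⟩)` over `ℂ` as soon as `a, b, c ≥ 2` and one of them is `≥ m ≥ 3` (the block dominates an
orientation of `⟨2,2,m⟩`; sub-format monotonicity `tensorRank_matMulTensor_mono`). [cite: Alekseev2015ChebyshevM22, Thm 1] -/
theorem three_mul_add_two_le_tensorRank_matMulTensor_of_le {a b c m : ℕ} (hm : 3 ≤ m) (ha : 2 ≤ a) (hb : 2 ≤ b)
    (hc : 2 ≤ c) (h : m ≤ a ∨ m ≤ b ∨ m ≤ c) : 3 * m + 2 ≤ tensorRank (matMulTensor ℂ a b c) := by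
  obtain ⟨h22m, h2m2, hm22⟩ := three_mul_add_two_le_tensorRank_matMulTensor_22m_perm hm
  rcases h with h | h | h
  · exact hm22.trans (tensorRank_matMulTensor_mono ℂ h hb hc)
  · exact h2m2.trans (tensorRank_matMulTensor_mono ℂ ha h hc)
  · exact h22m.trans (tensorRank_matMulTensor_mono ℂ ha hb h)

/-- `R(⟨a,b,c⟩) ≥ 11` over `ℂ` as soon as `a, b, c ≥ 2` and one of them is `≥ 3`.
[cite: Alekseyev1985, main theorem (zbMATH 0577.68059)] -/
theorem eleven_le_tensorRank_matMulTensor_of_le {a b c : ℕ} (ha : 2 ≤ a) (hb : 2 ≤ b) (hc : 2 ≤ c)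
    (h3 : 3 ≤ a ∨ 3 ≤ b ∨ 3 ≤ c) : 11 ≤ tensorRank (matMulTensor ℂ a b c) :=
  three_mul_add_two_le_tensorRank_matMulTensor_of_le le_rfl ha hb hc h3

/-- `R(⟨a,b,c⟩) ≥ 14` over `ℂ` as soon as `a, b, c ≥ 2` and one of them is `≥ 4`.
[cite: AlekseevSmirnov2013, Thm 1 (zbMATH 1317.68061)] -/
theorem fourteen_le_tensorRank_matMulTensor_of_le_four {a b c : ℕ} (ha : 2 ≤ a) (hb : 2 ≤ b) (hc : 2 ≤ c)
    (h4 : 4 ≤ a ∨ 4 ≤ b ∨ 4 ≤ c) : 14 ≤ tensorRank (matMulTensor ℂ a b c) :=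
  three_mul_add_two_le_tensorRank_matMulTensor_of_le (by norm_num) ha hb hc h4

/-- `R(⟨a,b,c⟩) ≥ 19` over `ℂ` as soon as `a, b, c ≥ 3`. [cite: Blaser2003, Corollary 9] -/
theorem nineteen_le_tensorRank_matMulTensor_of_three_le {a b c : ℕ} (ha : 3 ≤ a) (hb : 3 ≤ b) (hc : 3 ≤ c) :
    19 ≤ tensorRank (matMulTensor ℂ a b c) :=
  nineteen_le_tensorRank_matMulTensor_333.trans (tensorRank_matMulTensor_mono ℂ ha hb hc)

end Ranks

/-! ## Filter N7 with the exact ranks (kernel) -/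

section STPP

variable {H : Type*} [AddCommGroup H] [Fintype H] [DecidableEq H] {N : ℕ}

/-- **Filter N7 with one block dominating an orientation of `⟨2,2,m⟩`, `m ≥ 3` (kernel):** for an STPP family with
non-empty sets in a finite abelian `H`, a block `j₀` with all three sets of size `≥ 2` and one of size `≥ m`, and
directions `d` for the other blocks, `3m + 2 + ∑_{i ≠ j₀} gain(dᵢ;|Aᵢ|,|Bᵢ|,|Cᵢ|) ≤ |H|`; `m = 3` / `m = 4` are the
`223 ↦ 11` / `224 ↦ 14` rows of the engine's `paper` table, now print-fact free.
[cite: CohnKleinbergSzegedyUmans2005, Thm. 5.5] [cite: BuczynskiPostinghelRupniewski2020, §3.1 (first Lemma)] -/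
theorem three_mul_add_two_add_sum_gain_le_card_of_isSTPP (A B C : Fin N → Finset H) (hS : IsSTPP A B C)
    (hne : ∀ i, (A i).Nonempty ∧ (B i).Nonempty ∧ (C i).Nonempty) (d : Fin N → Fin 3) (j₀ : Fin N) {m : ℕ}
    (hm : 3 ≤ m) (h2 : 2 ≤ (A j₀).card ∧ 2 ≤ (B j₀).card ∧ 2 ≤ (C j₀).card)
    (hle : m ≤ (A j₀).card ∨ m ≤ (B j₀).card ∨ m ≤ (C j₀).card) :
    3 * m + 2 + ∑ i ∈ Finset.univ.erase j₀, gain (d i) (A i).card (B i).card (C i).card ≤ Fintype.card H := by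
  have h := tensorRank_add_sum_gain_le_card_of_isSTPP A B C hS hne d j₀
  have ht := three_mul_add_two_le_tensorRank_matMulTensor_of_le hm h2.1 h2.2.1 h2.2.2 hle
  omega

/-- **Filter N7 with one block dominating `⟨3,3,3⟩` (kernel):** `19 + ∑_{i ≠ j₀} gain(dᵢ;|Aᵢ|,|Bᵢ|,|Cᵢ|) ≤ |H|` when
block `j₀` has all three sets of size `≥ 3` (the `333 ↦ 19` row of the engine's `paper` table, print-fact free).
[cite: CohnKleinbergSzegedyUmans2005, Thm. 5.5] [cite: Blaser2003, Corollary 9] -/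
theorem nineteen_add_sum_gain_le_card_of_isSTPP (A B C : Fin N → Finset H) (hS : IsSTPP A B C)
    (hne : ∀ i, (A i).Nonempty ∧ (B i).Nonempty ∧ (C i).Nonempty) (d : Fin N → Fin 3) (j₀ : Fin N)
    (h3 : 3 ≤ (A j₀).card ∧ 3 ≤ (B j₀).card ∧ 3 ≤ (C j₀).card) :
    19 + ∑ i ∈ Finset.univ.erase j₀, gain (d i) (A i).card (B i).card (C i).card ≤ Fintype.card H := by
  have h := tensorRank_add_sum_gain_le_card_of_isSTPP A B C hS hne d j₀
  have ht := nineteen_le_tensorRank_matMulTensor_of_three_le h3.1 h3.2.1 h3.2.2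
  omega

/-- **One distinguished block, all other blocks thin (the frontier form of N7, kernel):** if every block other than `j₀`
has a set of size `1`, then `R(⟨|A_{j₀}|,|B_{j₀}|,|C_{j₀}|⟩) + ∑ᵢ |Aᵢ||Bᵢ||Cᵢ| ≤ |H| + |A_{j₀}||B_{j₀}||C_{j₀}|` (the thin
blocks peel at full volume, `gain_thinDir`; stated additively to avoid truncated subtraction).
[cite: CohnKleinbergSzegedyUmans2005, Thm. 5.5] [cite: BuczynskiPostinghelRupniewski2020, §3.1 (first Lemma)] -/
theorem tensorRank_add_sum_card_mul_le_of_isSTPP_of_thin (A B C : Fin N → Finset H) (hS : IsSTPP A B C)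
    (hne : ∀ i, (A i).Nonempty ∧ (B i).Nonempty ∧ (C i).Nonempty) (j₀ : Fin N)
    (hthin : ∀ i, i ≠ j₀ → (A i).card = 1 ∨ (B i).card = 1 ∨ (C i).card = 1) :
    tensorRank (matMulTensor ℂ (A j₀).card (B j₀).card (C j₀).card) + ∑ i, (A i).card * (B i).card * (C i).card ≤
      Fintype.card H + (A j₀).card * (B j₀).card * (C j₀).card := by
  have h := tensorRank_add_sum_gain_le_card_of_isSTPP A B C hS hne
    (fun i => thinDir (A i).card (B i).card (C i).card) j₀
  have e : ∑ i ∈ Finset.univ.erase j₀, gain (thinDir (A i).card (B i).card (C i).card) (A i).card (B i).card (C i).card =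
      ∑ i ∈ Finset.univ.erase j₀, (A i).card * (B i).card * (C i).card :=
    Finset.sum_congr rfl fun i hi => gain_thinDir (hthin i (Finset.ne_of_mem_erase hi))
  have e2 := Finset.sum_erase_add (Finset.univ : Finset (Fin N))
    (fun i => (A i).card * (B i).card * (C i).card) (Finset.mem_univ j₀)
  rw [e] at h
  omega

/-- **Numeric frontier form for a block dominating an orientation of `⟨2,2,m⟩`, `m ≥ 3`:** if block `j₀` has all three
sets of size `≥ 2` and one of size `≥ m`, and every other block is thin, then
`3m + 2 + ∑ᵢ |Aᵢ||Bᵢ||Cᵢ| ≤ |H| + |A_{j₀}||B_{j₀}||C_{j₀}|`. [cite: Alekseev2015ChebyshevM22, Thm 1] -/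
theorem three_mul_add_two_add_sum_card_mul_le_of_isSTPP_of_thin (A B C : Fin N → Finset H) (hS : IsSTPP A B C)
    (hne : ∀ i, (A i).Nonempty ∧ (B i).Nonempty ∧ (C i).Nonempty) (j₀ : Fin N) {m : ℕ} (hm : 3 ≤ m)
    (h2 : 2 ≤ (A j₀).card ∧ 2 ≤ (B j₀).card ∧ 2 ≤ (C j₀).card)
    (hle : m ≤ (A j₀).card ∨ m ≤ (B j₀).card ∨ m ≤ (C j₀).card)
    (hthin : ∀ i, i ≠ j₀ → (A i).card = 1 ∨ (B i).card = 1 ∨ (C i).card = 1) :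
    3 * m + 2 + ∑ i, (A i).card * (B i).card * (C i).card ≤
      Fintype.card H + (A j₀).card * (B j₀).card * (C j₀).card := by
  have h := tensorRank_add_sum_card_mul_le_of_isSTPP_of_thin A B C hS hne j₀ hthin
  have ht := three_mul_add_two_le_tensorRank_matMulTensor_of_le hm h2.1 h2.2.1 h2.2.2 hle
  omega

/-! ## The six ℤ₅₆ frontier leaves that `JOB_N7=paper` removes and `kernel` keeps, decided by theorem

Patterns `(|Aᵢ|,|Bᵢ|,|Cᵢ|)ᵢ` of the cell's ℤ₅₆ frontier (kit j267433, census.py record `002addb58b8ac4c4`): one block of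
type `⟨2,2,3⟩`, three thin blocks of total volume `46`, `∑ abc = 58`.  By the `m = 3` case of
`three_mul_add_two_add_sum_card_mul_le_of_isSTPP_of_thin`, `11 + 58 ≤ |H| + 12`, i.e. `|H| ≥ 57`. -/

omit [AddCommGroup H] [Fintype H] [DecidableEq H] in
/-- Non-emptiness of all sets from a card table with positive entries (helper for the leaf theorems). [folklore] -/
theorem nonempty_of_card_eq {M : ℕ} {A B C : Fin M → Finset H} {a b c : Fin M → ℕ}
    (hA : ∀ i, (A i).card = a i) (hB : ∀ i, (B i).card = b i) (hC : ∀ i, (C i).card = c i)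
    (hpos : ∀ i, 0 < a i ∧ 0 < b i ∧ 0 < c i) (i : Fin M) :
    (A i).Nonempty ∧ (B i).Nonempty ∧ (C i).Nonempty := by
  refine ⟨Finset.card_pos.1 ?_, Finset.card_pos.1 ?_, Finset.card_pos.1 ?_⟩
  · rw [hA]; exact (hpos i).1
  · rw [hB]; exact (hpos i).2.1
  · rw [hC]; exact (hpos i).2.2

/-- ℤ₅₆ leaf `{(1,3,4), (2,2,3), (3,1,6), (4,4,1)}` (`∑ abc = 58`): no STPP family with these cards in an abelian group
of order `≤ 56`. [cite: CohnKleinbergSzegedyUmans2005, Def. 5.1] -/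
theorem no_isSTPP_134_223_316_441 (hH : Fintype.card H ≤ 56) (A B C : Fin 4 → Finset H) (hS : IsSTPP A B C)
    (hA : ∀ i, (A i).card = ![1, 2, 3, 4] i) (hB : ∀ i, (B i).card = ![3, 2, 1, 4] i)
    (hC : ∀ i, (C i).card = ![4, 3, 6, 1] i) : False := by
  have hne := nonempty_of_card_eq hA hB hC (by intro i; fin_cases i <;> simp)
  have h := three_mul_add_two_add_sum_card_mul_le_of_isSTPP_of_thin A B C hS hne 1 (le_refl 3)
    (by simp [hA, hB, hC]) (by simp [hA, hB, hC]) (by intro i hi; fin_cases i <;> simp_all)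
  simp only [Fin.sum_univ_four, hA, hB, hC] at h
  simp at h
  omega

/-- ℤ₅₆ leaf `{(1,3,4), (2,3,2), (3,6,1), (4,1,4)}` (`∑ abc = 58`): no STPP family with these cards in an abelian group
of order `≤ 56`. [cite: CohnKleinbergSzegedyUmans2005, Def. 5.1] -/
theorem no_isSTPP_134_232_361_414 (hH : Fintype.card H ≤ 56) (A B C : Fin 4 → Finset H) (hS : IsSTPP A B C)
    (hA : ∀ i, (A i).card = ![1, 2, 3, 4] i) (hB : ∀ i, (B i).card = ![3, 3, 6, 1] i)
    (hC : ∀ i, (C i).card = ![4, 2, 1, 4] i) : False := by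
  have hne := nonempty_of_card_eq hA hB hC (by intro i; fin_cases i <;> simp)
  have h := three_mul_add_two_add_sum_card_mul_le_of_isSTPP_of_thin A B C hS hne 1 (le_refl 3)
    (by simp [hA, hB, hC]) (by simp [hA, hB, hC]) (by intro i hi; fin_cases i <;> simp_all)
  simp only [Fin.sum_univ_four, hA, hB, hC] at h
  simp at h
  omega

/-- ℤ₅₆ leaf `{(1,3,5), (2,2,3), (3,1,5), (4,4,1)}` (`∑ abc = 58`): no STPP family with these cards in an abelian group
of order `≤ 56`. [cite: CohnKleinbergSzegedyUmans2005, Def. 5.1] -/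
theorem no_isSTPP_135_223_315_441 (hH : Fintype.card H ≤ 56) (A B C : Fin 4 → Finset H) (hS : IsSTPP A B C)
    (hA : ∀ i, (A i).card = ![1, 2, 3, 4] i) (hB : ∀ i, (B i).card = ![3, 2, 1, 4] i)
    (hC : ∀ i, (C i).card = ![5, 3, 5, 1] i) : False := by
  have hne := nonempty_of_card_eq hA hB hC (by intro i; fin_cases i <;> simp)
  have h := three_mul_add_two_add_sum_card_mul_le_of_isSTPP_of_thin A B C hS hne 1 (le_refl 3)
    (by simp [hA, hB, hC]) (by simp [hA, hB, hC]) (by intro i hi; fin_cases i <;> simp_all)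
  simp only [Fin.sum_univ_four, hA, hB, hC] at h
  simp at h
  omega

/-- ℤ₅₆ leaf `{(1,3,5), (2,2,3), (4,4,1), (5,1,3)}` (`∑ abc = 58`): no STPP family with these cards in an abelian group
of order `≤ 56`. [cite: CohnKleinbergSzegedyUmans2005, Def. 5.1] -/
theorem no_isSTPP_135_223_441_513 (hH : Fintype.card H ≤ 56) (A B C : Fin 4 → Finset H) (hS : IsSTPP A B C)
    (hA : ∀ i, (A i).card = ![1, 2, 4, 5] i) (hB : ∀ i, (B i).card = ![3, 2, 4, 1] i)
    (hC : ∀ i, (C i).card = ![5, 3, 1, 3] i) : False := by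
  have hne := nonempty_of_card_eq hA hB hC (by intro i; fin_cases i <;> simp)
  have h := three_mul_add_two_add_sum_card_mul_le_of_isSTPP_of_thin A B C hS hne 1 (le_refl 3)
    (by simp [hA, hB, hC]) (by simp [hA, hB, hC]) (by intro i hi; fin_cases i <;> simp_all)
  simp only [Fin.sum_univ_four, hA, hB, hC] at h
  simp at h
  omega

/-- ℤ₅₆ leaf `{(1,3,5), (2,3,2), (4,1,4), (5,3,1)}` (`∑ abc = 58`): no STPP family with these cards in an abelian group
of order `≤ 56`. [cite: CohnKleinbergSzegedyUmans2005, Def. 5.1] -/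
theorem no_isSTPP_135_232_414_531 (hH : Fintype.card H ≤ 56) (A B C : Fin 4 → Finset H) (hS : IsSTPP A B C)
    (hA : ∀ i, (A i).card = ![1, 2, 4, 5] i) (hB : ∀ i, (B i).card = ![3, 3, 1, 3] i)
    (hC : ∀ i, (C i).card = ![5, 2, 4, 1] i) : False := by
  have hne := nonempty_of_card_eq hA hB hC (by intro i; fin_cases i <;> simp)
  have h := three_mul_add_two_add_sum_card_mul_le_of_isSTPP_of_thin A B C hS hne 1 (le_refl 3)
    (by simp [hA, hB, hC]) (by simp [hA, hB, hC]) (by intro i hi; fin_cases i <;> simp_all)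
  simp only [Fin.sum_univ_four, hA, hB, hC] at h
  simp at h
  omega

/-- ℤ₅₆ leaf `{(1,3,5), (2,3,2), (4,4,1), (5,1,3)}` (`∑ abc = 58`): no STPP family with these cards in an abelian group
of order `≤ 56`. [cite: CohnKleinbergSzegedyUmans2005, Def. 5.1] -/
theorem no_isSTPP_135_232_441_513 (hH : Fintype.card H ≤ 56) (A B C : Fin 4 → Finset H) (hS : IsSTPP A B C)
    (hA : ∀ i, (A i).card = ![1, 2, 4, 5] i) (hB : ∀ i, (B i).card = ![3, 3, 4, 1] i)
    (hC : ∀ i, (C i).card = ![5, 2, 1, 3] i) : False := by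
  have hne := nonempty_of_card_eq hA hB hC (by intro i; fin_cases i <;> simp)
  have h := three_mul_add_two_add_sum_card_mul_le_of_isSTPP_of_thin A B C hS hne 1 (le_refl 3)
    (by simp [hA, hB, hC]) (by simp [hA, hB, hC]) (by intro i hi; fin_cases i <;> simp_all)
  simp only [Fin.sum_univ_four, hA, hB, hC] at h
  simp at h
  omega

end STPP

end Summit.MatrixMultiplication.OmegaCensus.STPPRank

end
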